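import Summits.ValiantsHypothesis.ValiantsHypothesis.Theorems.GrenetZeonDualUnipotentThreeHalvesHeavyTopLevelTwoLifts
import Summits.ValiantsHypothesis.ValiantsHypothesis.Theorems.GrenetZeonDualUnipotentThreeHalvesHeavyTopLevelTwoFinal
import Summits.ValiantsHypothesis.ValiantsHypothesis.Theorems.GrenetZeonDualUnipotentThreeHalvesHeavyTopJordanShift
import Literature.LinearAlgebra.Matrix.GerstenhaberNilpotentSubspaceEqualityProof

/-!
# `GrenetZeon.DualUnipotentThreeHalves` (stmt-ValiantsHypothesis-24318) — P-Q1 kernel port (lead-g2 `Q1-PROOF.md`, port map L2.7/L2.8): LEVEL 2 COMPOSED,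
# AND THE THEOREM OF Q1 MODULO LEVEL 1: a codimension-one nilpotent subspace of `M_{s+1}(ℂ)` of generic type `(s,1)` is REDUCIBLE

Experiment cell «val-heavytop-census» (D-0160), engine seat val-htc-eng-1 (g3), kit 0; split of record (lead g3 03:00:55Z; L2.8 claimed 04:19Z).

* `single_eq_vecMulVec` — the two spellings of a matrix unit used by the two seats (`Matrix.single p q 1 = vecMulVec (Pi.single p 1) (Pi.single q 1)`).
* ★★★ `mulVec_single_zero_eq_zero_of_levelOne` — LEVEL 2 COMPOSED: with EXACTLY the hypotheses of eng-2 g3's ✓ `…HeavyTopLevelTwoLifts.lifts`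
  (`V ≤ M_{s+1}(ℂ)`, `s ≥ 3`, `Z^s = 0` on `V`, shift `A ∈ V`, and the Level-1 output `W = W⁽ᶜ⁾`: `hfin`, `hWinit`, `hc`, `hshape` verbatim), every `Z ∈ V`
  kills `e_0`.  Proof: ✓ `lifts` ⇒ the letter-wise hypotheses of this seat's ✓ `…HeavyTopLevelTwoFinal.mulVec_single_zero_eq_zero` (units re-spelt, `τ_j,
  γ_j` re-indexed by `ℕ`, and `V = span{ŵ_j, block-unit lifts, E_{iω}}` from the decomposition clause of `lifts`); ★★★ `not_irreducible_of_levelOne` —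
  hence `¬ (∀ U, V-invariant → U = ⊥ ∨ U = ⊤)`.
* ★★★ `not_irreducible_of_type_of_levelOne` — THE Q1 THEOREM MODULO LEVEL 1: `V ≤ M_{s+1}(ℂ)`, `Z^s = 0` on `V`, some `Z₀ ∈ V` with `Z₀^{s−1} ≠ 0`, and
  the Level-1 statement `hL1` for spaces containing the SHIFT (eng-2 g3's `…HeavyTopLevelOneSubspace.level_one_of_subspace`, ⧗ at writing — to be
  discharged by `exact` in a three-line corollary once it is in the tree, at `finrank V = C(s+1,2) − 1`) ⟹ `V` is NOT irreducible.  Proof: ✓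
  `…HeavyTopJordanShift.exists_isUnit_conj_eq_shift` (conjugate `Z₀` to `A`), Literature ✓ `GerstenhaberNilpotentSubspace.conjL` / `conjL_pow` /
  `finrank_map_conjL` (transport of `V` to `V' = P⁻¹VP`), `mulVec_single_zero_eq_zero_of_levelOne` (`V' e_0 = 0`), ✓
  `…HeavyTopCommonKernel.not_irreducible_of_common_kernel_conj` (back to `V`).

So, with eng-2 g3's Level 1, the kernel now holds lead-g2's THEOREM «a codimension-one nilpotent subspace of `M_{s'}(ℂ)` of generic type `(s'−1,1)` is
reducible, all `s' ≥ 4`» (Q1-PROOF.md) up to that one `exact`.  What it does NOT give: ι(7) ≤ 19 / (5,7) need the type-`(7)` half (Thm C(7)) and the MMS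
nilindex reduction (NOT commissioned, R340 (3)).  R2, 24318 OPEN / not moved; VP ≠ VNP NOT proved.  `--supports stmt-ValiantsHypothesis-24318 --as helper`.
No definitions, no named facts. [lead-g2 Q1-PROOF; eng-2 g3 ✓ `…LevelTwoChart`/`…LevelTwoLifts` (03:33Z–04:1xZ); this seat]
-/

set_option linter.dupNamespace false
set_option autoImplicit false

namespace Summit.ValiantsHypothesis.ValiantsHypothesis.Theorems.GrenetZeon.HeavyTopLevelTwo

open Matrix
open scoped BigOperators
open Summit.ValiantsHypothesis.ValiantsHypothesis.Theorems.GrenetZeon.HeavyTopLevelTwoLifts (lifts)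

variable {s : ℕ}

/-- A matrix unit in the two spellings used by the port: `Matrix.single p q 1 = vecMulVec (Pi.single p 1) (Pi.single q 1)`. -/
theorem single_eq_vecMulVec {n : Type*} [DecidableEq n] (p q : n) :
    Matrix.single p q (1 : ℂ) = vecMulVec (Pi.single p (1 : ℂ)) (Pi.single q (1 : ℂ)) := by
  ext i j
  rw [Matrix.single_apply, vecMulVec_apply, Pi.single_apply, Pi.single_apply]
  by_cases h : p = i ∧ q = j
  · obtain ⟨rfl, rfl⟩ := h
    simp
  · rw [if_neg h]
    by_cases hi : i = p
    · subst hi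
      have hj : j ≠ q := fun e => h ⟨rfl, e.symm⟩
      simp [hj]
    · simp [hi]

/-- ★★★ **LEVEL 2 COMPOSED (Q1-PROOF §2 in the kernel, abstract Level-1 input): the common kernel vector `e_0`.**  Let `V ≤ M_{s+1}(ℂ)` (`s ≥ 3`) with
`Z^s = 0` on `V` and the shift `A ∈ V`, and let `W` be its border-graded limit in the explicit form `W = W⁽ᶜ⁾` delivered by Level 1 (hypotheses `hfin`,
`hWinit`, `hshape` VERBATIM as in eng-2 g3's ✓ `…HeavyTopLevelTwoLifts.lifts` / `…HeavyTopLevelOneSubspace`).  Then every member of `V` kills `e_0`.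
Proof: ✓ `lifts` (the chart letters `Ê = E_{01} + γ`, `ŵ_j = E_{ωj} + τ_j + γ_j`, block-unit lifts, exact `E_{iω}`, and the decomposition of every
`Z ∈ V` in them) ⇒ the letter-wise hypotheses of ✓ `…HeavyTopLevelTwoFinal.mulVec_single_zero_eq_zero` (with `V = span` of the lifts). [this file] -/
theorem mulVec_single_zero_eq_zero_of_levelOne (hs : 3 ≤ s) (A : Matrix (Fin (s + 1)) (Fin (s + 1)) ℂ)
    (hA : ∀ i j : Fin (s + 1), A i j = if (j : ℕ) = i + 1 ∧ (j : ℕ) < s then 1 else 0)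
    (V W : Submodule ℂ (Matrix (Fin (s + 1)) (Fin (s + 1)) ℂ)) (hV : ∀ Z ∈ V, Z ^ s = 0) (hAV : A ∈ V)
    (hfin : Module.finrank ℂ W = Module.finrank ℂ V)
    (hWinit : ∀ Z ∈ V, ∀ d : ℤ, (∀ a b : Fin (s + 1),
        ((fun x : Fin (s + 1) => if x = Fin.last s then (0 : ℕ) else 1) a : ℤ) -
          (fun x : Fin (s + 1) => if x = Fin.last s then (0 : ℕ) else 1) b < d → Z a b = 0) →
      (Matrix.of fun a b : Fin (s + 1) =>
        if ((fun x : Fin (s + 1) => if x = Fin.last s then (0 : ℕ) else 1) a : ℤ) -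
            (fun x : Fin (s + 1) => if x = Fin.last s then (0 : ℕ) else 1) b = d then Z a b else 0) ∈ W)
    (c : ℕ) (hc : c ≤ s - 1)
    (hshape : ∀ Z : Matrix (Fin (s + 1)) (Fin (s + 1)) ℂ, Z ∈ W ↔ ∀ a b : Fin (s + 1), Z a b ≠ 0 →
      (a.val < b.val ∧ b ≠ Fin.last s) ∨ (b = Fin.last s ∧ a.val < c) ∨ (a = Fin.last s ∧ c < b.val ∧ b ≠ Fin.last s)) :
    ∀ Z ∈ V, Z *ᵥ Pi.single (0 : Fin (s + 1)) (1 : ℂ) = 0 := by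
  classical
  obtain ⟨E, γ, w, τ, γ', Lb, tb, ⟨hEV, hE, hγcol, hγω, hγrows⟩, hw, hLb, hunit, -, hdec⟩ :=
    lifts hs A hA V W hV hAV hfin hWinit c hc hshape
  have hωv : ((Fin.last s : Fin (s + 1)) : ℕ) = s := rfl
  have h1 : (1 : Fin (s + 1)) = ⟨1, by omega⟩ := Fin.ext (by rw [Fin.val_one']; exact Nat.mod_eq_of_lt (by omega))
  -- the generating set
  let G : Set (Matrix (Fin (s + 1)) (Fin (s + 1)) ℂ) :=
    {M | (∃ j : Fin (s + 1), c < j.val ∧ j.val < s ∧ M = w j) ∨ (∃ a b : Fin (s + 1), a.val < b.val ∧ b ≠ Fin.last s ∧ M = Lb a b) ∨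
      (∃ i : Fin (s + 1), i.val < c ∧ M = Matrix.single i (Fin.last s) (1 : ℂ))}
  have hGV : ∀ M ∈ G, M ∈ V := by
    rintro M (⟨j, hcj, hjs, rfl⟩ | ⟨a, b, hab, hb, rfl⟩ | ⟨i, hi, rfl⟩)
    · exact (hw j hcj hjs).1
    · exact (hLb a b hab hb).1
    · exact hunit i hi
  have hVG : V = Submodule.span ℂ G := by
    refine le_antisymm (fun Z hZ => ?_) (Submodule.span_le.2 hGV)
    rw [hdec Z hZ]
    refine Submodule.add_mem _ (Submodule.add_mem _ (Submodule.sum_mem _ fun j _ => ?_)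
      (Submodule.sum_mem _ fun a _ => Submodule.sum_mem _ fun b _ => ?_)) (Submodule.sum_mem _ fun i _ => ?_)
    · split_ifs with h
      · exact Submodule.smul_mem _ _ (Submodule.subset_span (Or.inl ⟨j, h.1, h.2, rfl⟩))
      · exact Submodule.zero_mem _
    · split_ifs with h
      · exact Submodule.smul_mem _ _ (Submodule.subset_span (Or.inr (Or.inl ⟨a, b, h.1, h.2, rfl⟩)))
      · exact Submodule.zero_mem _
    · split_ifs with h
      · exact Submodule.smul_mem _ _ (Submodule.subset_span (Or.inr (Or.inr ⟨i, h, rfl⟩)))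
      · exact Submodule.zero_mem _
  -- ℕ-indexed letters
  refine HeavyTopLevelTwoFinal.mulVec_single_zero_eq_zero (by omega) V hV A hA hAV c γ hγcol ?_ ?_
    (fun k => if h : k < s + 1 then τ ⟨k, h⟩ else 0) (fun k => if h : k < s + 1 then γ' ⟨k, h⟩ else 0) ?_ ?_ ?_ ?_ ?_ ?_ G hVG ?_
  · -- rows of `γ`
    intro p hp
    rcases hp with hp | hp
    · exact hγrows p (Or.inl hp)
    · by_cases hpω : p = Fin.last s
      · rw [hpω]; exact hγω
      · have : (p : ℕ) ≠ s := fun e => hpω (Fin.ext (by rw [hωv]; exact e))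
        exact hγrows p (Or.inr (by have := p.isLt; omega))
  · -- `Ê ∈ V`
    rw [← h1, ← single_eq_vecMulVec, ← hE]
    exact hEV
  · intro j hcj hjs l
    simp only [dif_pos (show j < s + 1 by omega)]
    exact (hw ⟨j, by omega⟩ hcj hjs).2.2.1 l
  · intro j hcj hjs l
    simp only [dif_pos (show j < s + 1 by omega)]
    exact (hw ⟨j, by omega⟩ hcj hjs).2.2.2.1 l
  · intro j hcj hjs
    simp only [dif_pos (show j < s + 1 by omega)]
    exact (hw ⟨j, by omega⟩ hcj hjs).2.2.2.2.1
  · intro j hcj hjs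
    simp only [dif_pos (show j < s + 1 by omega)]
    exact (hw ⟨j, by omega⟩ hcj hjs).2.2.2.2.2.1
  · intro j hcj hjs p r hr
    simp only [dif_pos (show j < s + 1 by omega)]
    exact (hw ⟨j, by omega⟩ hcj hjs).2.2.2.2.2.2.2 p r hr
  · intro j hcj hjs
    simp only [dif_pos (show j < s + 1 by omega)]
    rw [← single_eq_vecMulVec, ← (hw ⟨j, by omega⟩ hcj hjs).2.1]
    exact (hw ⟨j, by omega⟩ hcj hjs).1
  · -- the trichotomy of generators
    rintro M (⟨j, hcj, hjs, rfl⟩ | ⟨a, b, hab, hb, rfl⟩ | ⟨i, hi, rfl⟩)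
    · refine Or.inr (Or.inl ⟨j, hcj, hjs, ?_⟩)
      have hj : (⟨(j : ℕ), by omega⟩ : Fin (s + 1)) = j := Fin.ext rfl
      simp only [dif_pos (show (j : ℕ) < s + 1 by omega), hj]
      rw [← single_eq_vecMulVec]
      exact (hw j hcj hjs).2.1
    · refine Or.inr (Or.inr fun i => ?_)
      rw [(hLb a b hab hb).2.1, Matrix.add_apply, Matrix.single_apply, if_neg, zero_add,
        (hLb a b hab hb).2.2.1 i 0 (fun e => by have := congrArg Fin.val e; rw [hωv] at this; simp at this; omega)]
      rintro ⟨-, e⟩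
      rw [e, Fin.val_zero] at hab
      exact Nat.not_lt_zero _ hab
    · refine Or.inr (Or.inr fun i' => ?_)
      rw [Matrix.single_apply, if_neg]
      rintro ⟨-, e⟩
      have := congrArg Fin.val e
      rw [hωv] at this
      simp at this
      omega

/-- ★★★ **LEVEL 2 COMPOSED: `V` is REDUCIBLE** — the line `ℂe_0` is a non-trivial invariant subspace (the `hι7`-shaped predicate of
✓ `heavyTopInst_five_seven_of_iota7`).  For the un-conjugated space (generic element conjugated to `A` by ✓ `…HeavyTopJordanShift`) use
✓ `…HeavyTopCommonKernel.not_irreducible_of_common_kernel_conj` on `mulVec_single_zero_eq_zero_of_levelOne`. [this file] -/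
theorem not_irreducible_of_levelOne (hs : 3 ≤ s) (A : Matrix (Fin (s + 1)) (Fin (s + 1)) ℂ)
    (hA : ∀ i j : Fin (s + 1), A i j = if (j : ℕ) = i + 1 ∧ (j : ℕ) < s then 1 else 0)
    (V W : Submodule ℂ (Matrix (Fin (s + 1)) (Fin (s + 1)) ℂ)) (hV : ∀ Z ∈ V, Z ^ s = 0) (hAV : A ∈ V)
    (hfin : Module.finrank ℂ W = Module.finrank ℂ V)
    (hWinit : ∀ Z ∈ V, ∀ d : ℤ, (∀ a b : Fin (s + 1),
        ((fun x : Fin (s + 1) => if x = Fin.last s then (0 : ℕ) else 1) a : ℤ) -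
          (fun x : Fin (s + 1) => if x = Fin.last s then (0 : ℕ) else 1) b < d → Z a b = 0) →
      (Matrix.of fun a b : Fin (s + 1) =>
        if ((fun x : Fin (s + 1) => if x = Fin.last s then (0 : ℕ) else 1) a : ℤ) -
            (fun x : Fin (s + 1) => if x = Fin.last s then (0 : ℕ) else 1) b = d then Z a b else 0) ∈ W)
    (c : ℕ) (hc : c ≤ s - 1)
    (hshape : ∀ Z : Matrix (Fin (s + 1)) (Fin (s + 1)) ℂ, Z ∈ W ↔ ∀ a b : Fin (s + 1), Z a b ≠ 0 →
      (a.val < b.val ∧ b ≠ Fin.last s) ∨ (b = Fin.last s ∧ a.val < c) ∨ (a = Fin.last s ∧ c < b.val ∧ b ≠ Fin.last s)) :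
    ¬ ∀ U : Submodule ℂ (Fin (s + 1) → ℂ), (∀ Z ∈ V, ∀ x ∈ U, Z *ᵥ x ∈ U) → U = ⊥ ∨ U = ⊤ :=
  HeavyTopCommonKernel.not_irreducible_of_common_kernel (by omega) V (Pi.single 0 1)
    (by intro h; have := congrFun h 0; simp at this)
    (mulVec_single_zero_eq_zero_of_levelOne hs A hA V W hV hAV hfin hWinit c hc hshape)

/-! ## The top of the Q1 port, modulo the Level-1 statement: conjugate a generic element to the shift and come back -/

/-- ★★★ **CODIMENSION-ONE NILPOTENT SUBSPACES OF GENERIC TYPE `(s,1)` ARE REDUCIBLE — modulo Level 1 as an explicit hypothesis.**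
Let `V ≤ M_{s+1}(ℂ)` (`s ≥ 3`) with `Z^s = 0` on `V` and some `Z₀ ∈ V` with `Z₀^{s−1} ≠ 0` (generic Jordan type `(s,1)`).  ASSUME the Level-1 statement
`hL1` for every subspace `V'` with `Z^s = 0` on `V'`, containing the shift `A = J ⊕ 0`, and of the same dimension as `V` (this is eng-2 g3's
`…HeavyTopLevelOneSubspace.level_one_of_subspace` at `finrank = C(s+1,2) − 1`, to be discharged by `exact` once it is in the tree; stated here in the
VERBATIM shape consumed by ✓ `lifts`).  Then `V` is NOT irreducible.
Proof: ✓ `…HeavyTopJordanShift.exists_isUnit_conj_eq_shift` conjugates `Z₀` to `A`; the conjugated space `V' = P⁻¹ V P` (Literature ✓ `conjL`,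
`finrank_map_conjL`, `conjL_pow`) satisfies the hypotheses; `mulVec_single_zero_eq_zero_of_levelOne` gives `V' e_0 = 0`; ✓
`not_irreducible_of_common_kernel_conj` returns to `V`. [lead-g2 Q1-PROOF (statement); this file] -/
theorem not_irreducible_of_type_of_levelOne (hs : 3 ≤ s) (V : Submodule ℂ (Matrix (Fin (s + 1)) (Fin (s + 1)) ℂ))
    (hV : ∀ Z ∈ V, Z ^ s = 0) (Z₀ : Matrix (Fin (s + 1)) (Fin (s + 1)) ℂ) (hZ₀ : Z₀ ∈ V) (hZ₀' : Z₀ ^ (s - 1) ≠ 0)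
    (hL1 : ∀ V' : Submodule ℂ (Matrix (Fin (s + 1)) (Fin (s + 1)) ℂ), (∀ Z ∈ V', Z ^ s = 0) →
      (Matrix.of fun i j : Fin (s + 1) => if (j : ℕ) = i + 1 ∧ (j : ℕ) < s then (1 : ℂ) else 0) ∈ V' →
      Module.finrank ℂ V' = Module.finrank ℂ V →
      ∃ (W : Submodule ℂ (Matrix (Fin (s + 1)) (Fin (s + 1)) ℂ)) (c : ℕ),
        Module.finrank ℂ W = Module.finrank ℂ V' ∧
        (∀ Z ∈ V', ∀ d : ℤ, (∀ a b : Fin (s + 1),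
            ((fun x : Fin (s + 1) => if x = Fin.last s then (0 : ℕ) else 1) a : ℤ) -
              (fun x : Fin (s + 1) => if x = Fin.last s then (0 : ℕ) else 1) b < d → Z a b = 0) →
          (Matrix.of fun a b : Fin (s + 1) =>
            if ((fun x : Fin (s + 1) => if x = Fin.last s then (0 : ℕ) else 1) a : ℤ) -
                (fun x : Fin (s + 1) => if x = Fin.last s then (0 : ℕ) else 1) b = d then Z a b else 0) ∈ W) ∧
        c ≤ s - 1 ∧
        (∀ Z : Matrix (Fin (s + 1)) (Fin (s + 1)) ℂ, Z ∈ W ↔ ∀ a b : Fin (s + 1), Z a b ≠ 0 →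
          (a.val < b.val ∧ b ≠ Fin.last s) ∨ (b = Fin.last s ∧ a.val < c) ∨ (a = Fin.last s ∧ c < b.val ∧ b ≠ Fin.last s))) :
    ¬ ∀ U : Submodule ℂ (Fin (s + 1) → ℂ), (∀ Z ∈ V, ∀ x ∈ U, Z *ᵥ x ∈ U) → U = ⊥ ∨ U = ⊤ := by
  classical
  -- conjugate the generic element to the shift
  obtain ⟨P, hP, hPA⟩ := HeavyTopJordanShift.exists_isUnit_conj_eq_shift (by omega) Z₀ (hV Z₀ hZ₀) hZ₀'
  set A : Matrix (Fin (s + 1)) (Fin (s + 1)) ℂ := Matrix.of fun i j : Fin (s + 1) => if (j : ℕ) = i + 1 ∧ (j : ℕ) < s then (1 : ℂ) else 0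
  have hA : ∀ i j : Fin (s + 1), A i j = if (j : ℕ) = i + 1 ∧ (j : ℕ) < s then 1 else 0 := fun i j => rfl
  -- the conjugated space `V' = P⁻¹ V P`
  set Q : (Matrix (Fin (s + 1)) (Fin (s + 1)) ℂ)ˣ := hP.unit⁻¹ with hQ
  have hQv : (Q : Matrix (Fin (s + 1)) (Fin (s + 1)) ℂ) = P⁻¹ := by
    rw [hQ, Matrix.coe_units_inv, IsUnit.unit_spec]
  have hQi : ((Q⁻¹ : (Matrix (Fin (s + 1)) (Fin (s + 1)) ℂ)ˣ) : Matrix (Fin (s + 1)) (Fin (s + 1)) ℂ) = P := by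
    rw [hQ, inv_inv, IsUnit.unit_spec]
  have hconj : ∀ Z, Literature.LinearAlgebra.Matrix.GerstenhaberNilpotentSubspace.conjL Q Z = P⁻¹ * Z * P := by
    intro Z
    rw [Literature.LinearAlgebra.Matrix.GerstenhaberNilpotentSubspace.conjL_apply, hQv, hQi]
  set V' := V.map (Literature.LinearAlgebra.Matrix.GerstenhaberNilpotentSubspace.conjL Q :
    Matrix (Fin (s + 1)) (Fin (s + 1)) ℂ →ₗ[ℂ] Matrix (Fin (s + 1)) (Fin (s + 1)) ℂ) with hV'
  have hmem : ∀ Z ∈ V, P⁻¹ * Z * P ∈ V' := fun Z hZ => Submodule.mem_map.2 ⟨Z, hZ, hconj Z⟩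
  have hV's : ∀ Z' ∈ V', Z' ^ s = 0 := by
    rintro Z' hZ'
    obtain ⟨Z, hZ, rfl⟩ := Submodule.mem_map.1 hZ'
    show (Literature.LinearAlgebra.Matrix.GerstenhaberNilpotentSubspace.conjL Q Z) ^ s = 0
    rw [Literature.LinearAlgebra.Matrix.GerstenhaberNilpotentSubspace.conjL_pow, hV Z hZ, map_zero]
  have hAV' : A ∈ V' := by
    rw [← hPA]
    exact hmem Z₀ hZ₀
  have hfin' : Module.finrank ℂ V' = Module.finrank ℂ V :=
    Literature.LinearAlgebra.Matrix.GerstenhaberNilpotentSubspace.finrank_map_conjL Q V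
  obtain ⟨W, c, hfin, hWinit, hc, hshape⟩ := hL1 V' hV's hAV' hfin'
  have hker := mulVec_single_zero_eq_zero_of_levelOne hs A hA V' W hV's hAV' hfin hWinit c hc hshape
  exact HeavyTopCommonKernel.not_irreducible_of_common_kernel_conj (by omega) V P hP (Pi.single 0 1)
    (by intro h; have := congrFun h 0; simp at this) fun Z hZ => hker _ (hmem Z hZ)

end Summit.ValiantsHypothesis.ValiantsHypothesis.Theorems.GrenetZeon.HeavyTopLevelTwo
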